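import Summits.CriticalPhenomena.CardyFormulaZ2.Theorems.CardyComplexConeParafermionToSLESixFamiliesPercKSBoxFaceReduction2
import Summits.CriticalPhenomena.CardyFormulaZ2.Theorems.CardyComplexConeParafermionToSLESixFamiliesFaceKernelColouring
import Summits.CriticalPhenomena.CardyFormulaZ2.Theorems.CardyComplexConeParafermionToSLESixFamiliesFaceKernelRotation
import Summits.CriticalPhenomena.CardyFormulaZ2.Theorems.CardyComplexConeParafermionToSLESixFamiliesFaceKernelClosedCell
import HarnessLib

/-!
# Face kernel (K1): compacts of the Jordan domain lie in the oriented face domains — assembly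

Route `CardyComplexCone` (sub-problem `CriticalPhenomena/CardyFormulaZ2`), crux
`Summit.CriticalPhenomena.CardyFormulaZ2.Theses.CardyComplexCone.ParafermionToSLESixFamilies`
(item stmt-CriticalPhenomena-11389), line `face-kernel-k1` (lead c4): the assembly stub
`stub_percFaceK1_of` of the skeleton `Cruxes/ParafermionToSLESixFamilies/Lines/face_kernel_k1.lean`.
Its four hypotheses are, verbatim, the four landed lattice/topology stubs
`stub_isInnerFace_near_compact` (`…FaceKernelInnerNearCompact.lean`),
`stub_W_eq_of_isPathConnected` (`…FaceKernelWPathConnected.lean`),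
`stub_exists_isOutEdge_east` (`…FaceKernelEastMarch.lean`) and `stub_exists_vertex_near`
(`…FaceKernelVertexNear.lean`); its conclusion is the kernel input (K1)
`CaratheodoryNetSlitUniformity.PercFaceK1` of `…PercKSBoxFaceReduction2.lean` — the one
research-free input of `PercKSBoxData` (`percKSBoxData_of_K1`).

## Proof

Fix `D`, a family `Λ`, positive admissible meshes `δ_k → 0` and a nonempty compact `K ⊆ D`.
Pick interior points `b'` of the arc `(ba) = D.arc 1` and `a'` of `(ab) = D.arc 0`, at distance
`≥ r₀ > 0` from the other arc (`exists_pos_forall_mem_arc_of_dist_lt`), points `p_b, p_a ∈ D`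
within `r₀/16` of them, and a compact path-connected `K⁺ ⊆ D` containing `K ∪ {p_a, p_b}`
(`exists_isCompact_isPathConnected_superset`). For large `k` (stub A on `K⁺`; the colouring
lemmas `eventually_not_mem_zdArcA/B`; `δ_k < r₀/16`), with `E = Λ δ_k`:
every closed cell meeting `K⁺` is an inner face; marching east from the face `F₀` of a point
`z₀ ∈ K` gives a face-boundary dart `d₁` (stub D) and its full boundary cycle `Z₁`; the left face
of `d₁` has winding number `1` (`W_bloop_left_eq_one`), hence so has `F₀` (stub D), hence the face
of every point of `K⁺` (stub C). By stub E the cycle has vertices within `r₀/16 + δ_k < r₀/4` of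
`b'` and of `a'`; the first is off the discrete arc of `A`, the second off the arc of `B` hence on
the arc of `A` (admissibility). By `bcycle_W_eq_of_colours` the winding numbers of `Z₁` are those
of the boundary cycle from `e_a`, so the face of every `z ∈ K` has winding number `1` for it, and
`z` lies in the face domain (`mem_faceDomain_of_W_ne_zero`), which is the carrier of the oriented
face domain (`carrier_orientedFaceDomain`).
-/

noncomputable section

open scoped Topology
open Filter Set Metric
open Literature.Probability Literature.Probability.LatticeModels Literature.Probability.Percolation
open Literature.Probability.LatticeModels.DiscreteDobrushin Literature.Probability.LatticeModels.Mesh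
open Literature.Probability.RandomPlanarGeometry
open Summit.CriticalPhenomena.CardyFormulaZ2.Cruxes.ParafermionToSLESixFamilies.CaratheodoryNetSlitUniformity

namespace Summit.CriticalPhenomena.CardyFormulaZ2.Cruxes.ParafermionToSLESixFamilies.FaceKernel

/-! ### The face of a point -/

/-- Real part of `δ⁻¹ * w` for real `δ`. -/
theorem re_ofReal_inv_mul (δ : ℝ) (w : ℂ) : ((δ : ℂ)⁻¹ * w).re = δ⁻¹ * w.re := by
  rw [← Complex.ofReal_inv, Complex.re_ofReal_mul]

/-- Imaginary part of `δ⁻¹ * w` for real `δ`. -/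
theorem im_ofReal_inv_mul (δ : ℝ) (w : ℂ) : ((δ : ℂ)⁻¹ * w).im = δ⁻¹ * w.im := by
  rw [← Complex.ofReal_inv, Complex.im_ofReal_mul]

/-- **The face of a point.** Every point lies in the closed cell of the lattice face
`flFace (δ⁻¹ w)` (the face of its floor coordinates). -/
theorem exists_face_of_point {δ : ℝ} (hδ : 0 < δ) (w : ℂ) :
    ∃ F : Site 2, w ∈ closure (cell δ (F 0) (F 1)) ∧ flFace ((δ : ℂ)⁻¹ * w) = toZ2 F := by
  refine ⟨![⌊w.re / δ⌋, ⌊w.im / δ⌋], ?_, ?_⟩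
  · rw [closure_cell hδ]
    simp only [Matrix.cons_val_zero, Matrix.cons_val_one]
    have h1 := (le_div_iff₀ hδ).1 (Int.floor_le (w.re / δ))
    have h2 := (div_lt_iff₀ hδ).1 (Int.lt_floor_add_one (w.re / δ))
    have h3 := (le_div_iff₀ hδ).1 (Int.floor_le (w.im / δ))
    have h4 := (div_lt_iff₀ hδ).1 (Int.lt_floor_add_one (w.im / δ))
    refine Complex.mem_reProdIm.2 ⟨⟨?_, ?_⟩, ?_, ?_⟩ <;> linarith [mul_comm δ (⌊w.re / δ⌋ : ℝ),
      mul_comm δ ((⌊w.re / δ⌋ : ℝ) + 1), mul_comm δ (⌊w.im / δ⌋ : ℝ), mul_comm δ ((⌊w.im / δ⌋ : ℝ) + 1)]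
  · simp only [flFace, re_ofReal_inv_mul, im_ofReal_inv_mul, toZ2_mk, Matrix.cons_val_zero,
      Matrix.cons_val_one]
    rw [inv_mul_eq_div, inv_mul_eq_div]

/-! ### The assembly -/

/-- **(K1) for the oriented face domains of a discretisation family**, assembled from the four
lattice/topology stubs of the line (their statements are the four hypotheses, in the order A, C,
D, E of the skeleton `Lines/face_kernel_k1.lean`). See the module docstring for the proof. -/
theorem stub_percFaceK1_of :
    (∀ (J : JordanDomain) (K : Set ℂ), IsCompact K → K ⊆ J.carrier →
      ∃ δ₀ > 0, ∀ (E : DiscreteDobrushin), E.Ω = J.carrier → 0 < E.δ → E.δ < δ₀ →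
        ∀ (F : Site 2) (z : ℂ), z ∈ K → z ∈ closure (cell E.δ (F 0) (F 1)) → E.IsInnerFace F) →
    (∀ (E : DiscreteDobrushin), 0 < E.δ → ∀ (d₀ : Site 2 × Fin 4), E.IsOutEdge d₀.1 d₀.2 →
      ∀ (i m : ℕ) (hm : 0 < m) (hcl : (E.bwalk d₀ (i + m)).1 = (E.bwalk d₀ i).1) (S : Set ℂ),
        IsPathConnected S →
        (∀ (F : Site 2) (z : ℂ), z ∈ S → z ∈ closure (cell E.δ (F 0) (F 1)) → E.IsInnerFace F) →
        ∀ z ∈ S, ∀ w ∈ S,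
          (bloop i m hm hcl).W (flFace ((E.δ : ℂ)⁻¹ * z)) =
            (bloop i m hm hcl).W (flFace ((E.δ : ℂ)⁻¹ * w))) →
    (∀ (E : DiscreteDobrushin), E.IsZdAdmissible → ∀ (F : Site 2), E.IsInnerFace F →
      ∃ j : ℕ, E.IsOutEdge (F + (j + 1) • cornerUnit 0) 1 ∧
        ∀ (d₀ : Site 2 × Fin 4), E.IsOutEdge d₀.1 d₀.2 →
          ∀ (i m : ℕ) (hm : 0 < m) (hcl : (E.bwalk d₀ (i + m)).1 = (E.bwalk d₀ i).1),
            (bloop i m hm hcl).W (toZ2 (faceAt (F + (j + 1) • cornerUnit 0) 1)) =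
              (bloop i m hm hcl).W (toZ2 F)) →
    (∀ (E : DiscreteDobrushin), 0 < E.δ → IsOpen E.Ω → IsConnected (closure E.Ω)ᶜ →
      ¬ Bornology.IsBounded (closure E.Ω)ᶜ → frontier E.Ω ⊆ closure (closure E.Ω)ᶜ →
      ∀ (d₀ : Site 2 × Fin 4), E.IsOutEdge d₀.1 d₀.2 →
      ∀ (i m : ℕ) (hm : 0 < m) (hcl : (E.bwalk d₀ (i + m)).1 = (E.bwalk d₀ i).1)
        (p b : ℂ) (r : ℝ), b ∈ frontier E.Ω → dist p b < r →
        (bloop i m hm hcl).W (flFace ((E.δ : ℂ)⁻¹ * p)) ≠ 0 →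
        ∃ t < m, dist (meshPoint E.δ (E.bwalk d₀ (i + t)).1) b < r + E.δ) →
    PercFaceK1 := by
  intro hA hC hD hEv D Λ hΛ δs hpos hlim hadm K hK hKD
  rcases K.eq_empty_or_nonempty with rfl | ⟨z₀, hz₀⟩
  · exact Eventually.of_forall fun k => empty_subset _
  /- two interior arc points `b' ∈ (ba)`, `a' ∈ (ab)`, at distance `≥ r₀` from the other arc -/
  have htb := D.midpoint_mem_Ioo 1
  have hta := D.midpoint_mem_Ioo 0
  set b' : ℂ := D.boundary ((D.mark 1 + D.nextMark 1) / 2) with hb'def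
  set a' : ℂ := D.boundary ((D.mark 0 + D.nextMark 0) / 2) with ha'def
  obtain ⟨rb, hrb, -, hrbfar⟩ := D.exists_pos_forall_mem_arc_of_dist_lt 1 htb
  obtain ⟨ra, hra, -, hrafar⟩ := D.exists_pos_forall_mem_arc_of_dist_lt 0 hta
  set r₀ : ℝ := min rb ra with hr₀def
  have hr₀ : 0 < r₀ := lt_min hrb hra
  have hb'fr : b' ∈ frontier D.carrier := D.boundary_mem_frontier _
  have ha'fr : a' ∈ frontier D.carrier := D.boundary_mem_frontier _
  have hb'arc : b' ∈ D.arc 1 := ⟨_, ⟨htb.1.le, htb.2.le⟩, rfl⟩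
  have ha'arc : a' ∈ D.arc 0 := ⟨_, ⟨hta.1.le, hta.2.le⟩, rfl⟩
  have hTb : ∀ z ∈ D.arc 0, r₀ ≤ dist z b' := fun z hz =>
    (min_le_left _ _).trans (hrbfar 0 (by decide) z hz)
  have hTa : ∀ z ∈ D.arc 1, r₀ ≤ dist z a' := fun z hz =>
    (min_le_right _ _).trans (hrafar 1 (by decide) z hz)
  /- interior points near them -/
  obtain ⟨pb, hpbD, hpb⟩ := D.exists_mem_carrier_dist_lt 1 hb'arc (by positivity : (0 : ℝ) < r₀ / 16)
  obtain ⟨pa, hpaD, hpa⟩ := D.exists_mem_carrier_dist_lt 0 ha'arc (by positivity : (0 : ℝ) < r₀ / 16)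
  /- the compact path-connected hull of `K ∪ {pa, pb}` -/
  have hDpc : IsPathConnected D.carrier :=
    (D.isOpen.isConnected_iff_isPathConnected).1 D.isConnected
  obtain ⟨Kp, hKpc, hKppc, hK₁Kp, hKpD⟩ := exists_isCompact_isPathConnected_superset D.isOpen hDpc
    ((hK.union (Set.toFinite {pa, pb}).isCompact)) (union_subset hKD (by
      rintro x (rfl | rfl); exacts [hpaD, hpbD])) ⟨z₀, Or.inl hz₀⟩
  have hz₀K : z₀ ∈ Kp := hK₁Kp (Or.inl hz₀)
  have hpaK : pa ∈ Kp := hK₁Kp (Or.inr (Or.inl rfl))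
  have hpbK : pb ∈ Kp := hK₁Kp (Or.inr (Or.inr rfl))
  /- stub A on the hull -/
  obtain ⟨δ₀, hδ₀, hinner⟩ := hA D.toJordanDomain Kp hKpc hKpD
  /- eventualities along the meshes -/
  have hlim' : Tendsto δs atTop (𝓝[>] 0) :=
    tendsto_nhdsWithin_iff.2 ⟨hlim, Eventually.of_forall hpos⟩
  have hevB := hlim'.eventually (eventually_not_mem_zdArcA hΛ hb'fr hr₀ hTb)
  have hevA := hlim'.eventually (eventually_not_mem_zdArcB hΛ ha'fr hr₀ hTa)
  have hev1 : ∀ᶠ k in atTop, δs k < δ₀ := hlim (Iio_mem_nhds hδ₀)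
  have hev2 : ∀ᶠ k in atTop, δs k < r₀ / 16 := hlim (Iio_mem_nhds (by positivity))
  filter_upwards [hevB, hevA, hev1, hev2] with k hkB hkA hk1 hk2
  /- the datum at scale `δs k` -/
  intro z hz
  rw [carrier_orientedFaceDomain]
  set E := Λ (δs k) with hEdef
  have hE : E.IsZdAdmissible := hadm k
  obtain ⟨hΩo, hext, hunb, hfr⟩ := regular_of_zdDiscretisationFamily hΛ (δs k)
  have hδE : E.δ = δs k := hΛ.δ_eq _
  have hΩE : E.Ω = D.carrier := hΛ.Ω_eq _
  have hδ : 0 < E.δ := hE.delta_pos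
  have hin : ∀ (F : Site 2) (w : ℂ), w ∈ Kp → w ∈ closure (cell E.δ (F 0) (F 1)) →
      E.IsInnerFace F := hinner E hΩE hδ (by rw [hδE]; exact hk1)
  /- the bulk boundary cycle: east march from the face of `z₀` -/
  obtain ⟨F₀, hF₀cl, hF₀fl⟩ := exists_face_of_point hδ z₀
  have hF₀ : E.IsInnerFace F₀ := hin F₀ z₀ hz₀K hF₀cl
  obtain ⟨j, hout, hchain⟩ := hD E hE F₀ hF₀
  set d₁ : Site 2 × Fin 4 := (F₀ + (j + 1) • cornerUnit 0, 1) with hd₁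
  have h₁ : E.IsOutEdge d₁.1 d₁.2 := hout
  have hm₁ : 0 < bperiod hE h₁ := bperiod_pos hE h₁
  have hcl₁ : (E.bwalk d₁ (0 + bperiod hE h₁)).1 = (E.bwalk d₁ 0).1 := by
    rw [zero_add, bwalk_bperiod, bwalk_zero]
  -- winding number one at the left face of `d₁`, at `F₀`, at `z₀`, on the hull
  have hW1 : (bloop 0 (bperiod hE h₁) hm₁ hcl₁).W (toZ2 (faceAt d₁.1 d₁.2)) = 1 := by
    have := W_bloop_left_eq_one (i := 0) (hm := hm₁) (hcl := hcl₁) hE h₁ le_rfl hΩo hext hunb hfr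
      (t := 0) hm₁
    simpa using this
  have hWF₀ : (bloop 0 (bperiod hE h₁) hm₁ hcl₁).W (toZ2 F₀) = 1 := by
    rw [← hchain d₁ h₁ 0 _ hm₁ hcl₁]; exact hW1
  have hWz₀ : (bloop 0 (bperiod hE h₁) hm₁ hcl₁).W (flFace ((E.δ : ℂ)⁻¹ * z₀)) = 1 := by
    rw [hF₀fl]; exact hWF₀
  have hWK : ∀ w ∈ Kp, (bloop 0 (bperiod hE h₁) hm₁ hcl₁).W (flFace ((E.δ : ℂ)⁻¹ * w)) = 1 :=
    fun w hw => by rw [← hC E hδ d₁ h₁ 0 _ hm₁ hcl₁ Kp hKppc hin z₀ hz₀K w hw]; exact hWz₀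
  /- vertices of the cycle near `b'` and near `a'`, and their colours -/
  have hsmall : r₀ / 16 + E.δ < r₀ / 4 := by rw [hδE]; linarith
  obtain ⟨sb, -, hsb⟩ := hEv E hδ hΩo hext hunb hfr d₁ h₁ 0 _ hm₁ hcl₁ pb b' (r₀ / 16)
    (by rw [hΩE]; exact hb'fr) hpb (by rw [hWK pb hpbK]; exact one_ne_zero)
  obtain ⟨sa, -, hsa⟩ := hEv E hδ hΩo hext hunb hfr d₁ h₁ 0 _ hm₁ hcl₁ pa a' (r₀ / 16)
    (by rw [hΩE]; exact ha'fr) hpa (by rw [hWK pa hpaK]; exact one_ne_zero)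
  have hcolB : (E.bwalk d₁ (0 + sb)).1 ∉ E.zdArcA :=
    hkB hE _ (by rw [← hδE]; linarith)
  have hcolA : (E.bwalk d₁ (0 + sa)).1 ∈ E.zdArcA := by
    have hnotB : (E.bwalk d₁ (0 + sa)).1 ∉ E.zdArcB := hkA hE _ (by rw [← hδE]; linarith)
    exact (hE.zdBoundary_subset (bwalk_fst_mem_zdBoundary h₁ _)).resolve_right hnotB
  /- so the cycle is the boundary cycle from `e_a`, and the face of `z` is inside -/
  have hzKp : z ∈ Kp := hK₁Kp (Or.inl hz)
  obtain ⟨F, hFcl, hFfl⟩ := exists_face_of_point hδ z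
  have hWz : (bcycle hE).W (toZ2 F) ≠ 0 := by
    rw [bcycle_W_eq_of_colours hE h₁ hcolA hcolB (hm := hm₁) (hcl := hcl₁), ← hFfl, hWK z hzKp]
    exact one_ne_zero
  exact mem_faceDomain_of_W_ne_zero hE hΩo hext hunb hfr hWz hFcl (fun F' hF' => hin F' z hzKp hF')


end Summit.CriticalPhenomena.CardyFormulaZ2.Cruxes.ParafermionToSLESixFamilies.FaceKernel

end
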